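import Summits.Ventures.Crystal3D.Theorems.StickyWulffConstantTextureLiminfTexShadowSplitDefs
import Summits.Ventures.Crystal3D.Theorems.StickyWulffConstantGenericWallFloorSampleDeficitUpper
import Summits.Ventures.Crystal3D.StickySpheres.FinsetBridge
import HarnessLib

/-!
# Lane G's NON-RESIDUAL law per pair, and the deficiency ⇒ ADHESION currency converse (crux `GenericWallFloor`,
# stmt-Ventures-19480, line `WallLedgerG`; for lane T's fcc|fcc on-reach cells, cf-p1 (xlv″) 2026-08-28T22:11Z «(1)(2) GO per pair»)

HONEST FRAMING. Venture `Summits/Ventures/Crystal3D` (cell `crystal3d-full`), helper `--supports` the crux `GenericWallFloor` of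
`route-Ventures-StickyWulffConstant`, REGISTERED line `WallLedgerG`, open stub `stub_twoSlabAdhesion`.  BOOKKEEPING (census-free,
standard axioms); F-C1 not moved; NOT the crux: `ExactOnly`(C12-55) [E1] and `StarPairFar` [certified] stay BY NAME, and the
residual class stays OPEN.

WHY.  Lane T's registered-class stubs for fcc|fcc plates (`fam*Fcc`, TexShadow v6.17) contain, besides the co-axial affine pairs
(lane F's import), NON-co-axial pairs (`Σ9/Σ27`-registered: a family frame coincides, the affine plates do not); by T's hypothesis
`hgen : ¬ InResidualClass` those are exactly lane G's PRICED classes.  This file exports that fact per pair, in G's quantifier shape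
of today (constants AFTER the pair — see the planner's R2″ for the locally-uniform upgrade), in both currencies:
* **`genericWallFloorAt_of_not_residual`** — `¬coax → ¬(RayAlignedAt ∧ ¬Σ9×6 ∧ ¬SeparatedWideAt ∧ RegisteredAt) → GenericWallFloorAt`
  (the case analysis of `genericWallFloor_of_registeredResidualWide`, run for ONE pair: `…chain_of_far`, the six `Σ9` cells,
  `…of_separatedWideAt`, `…of_not_registeredAt`), and **`genericWallFloorAt_of_not_inResidualClass`** — the same keyed on T's
  `InResidualClass` (`…TexShadowSplitDefs`), i.e. `¬coax → ¬InResidualClass A₁ A₂ t₁ t₂ → GenericWallFloorAt A₁ t₁ A₂ t₂`;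
* **`crossBound_of_deficiencyBound`** — the POINTWISE currency converse: for one cell `(X, P₁, P₂)` with complete clamped fcc plates,
  the deficiency-form inequality `(φ₁+φ₂+c)πρ² − C(1+h)ρ ≤ D(X)` implies the ADHESION form
  `cross₁ + cross₂ ≤ D(Y) + (φ₁+φ₂−c)πρ² + (C(1+h) + C₁ + C₂)ρ` through `contactDeficiency_sdiff_split` ×2 and the UPPER face
  counts `D(Pᵢ) ≤ 2φᵢπρ² + Cᵢρ` (`affineSampleDeficit_upper`); packaged per pair as **`twoSlabLedgerAt_of_atCharge`**: an
  At-matrix at explicit `(C, R₀)`, `1 ≤ R₀`, gives `TwoSlabLedgerAt c` (the route decl's `GenericWallFloorAtCharge` hides `R₀ > 0`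
  only, so the converse is stated on the matrix, not on the `∃`).
WHAT THIS IS NOT: no uniformity in the pair (R2″ is a re-threading of the ledgers, not done here); no statement about the residual
class; `½·innerBonds`/table currency is lane T's glue (wulff-p2); F-C1 not moved.
-/

noncomputable section

namespace Summit.Ventures.Crystal3D.Theorems

open Summit.Ventures.Crystal3D Finset
open Literature.MathematicalPhysics.StatisticalMechanics (fccStacking barlowStacking IsHaggSeq contactDeficiency)
open scoped InnerProductSpace

/-! ## The non-residual law per pair (deficiency currency) -/

/-- **Lane G's priced classes, per pair**: a NON-co-axial pair of moved fcc lattices that is NOT in the residual class of record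
(`RayAlignedAt ∧` outside the six `Σ9` cells `∧ ¬SeparatedWideAt ∧ RegisteredAt`) satisfies the crux's matrix `GenericWallFloorAt`
(`c₀ = 1`), modulo `ExactOnly`(C12-55) and `StarPairFar`. -/
theorem genericWallFloorAt_of_not_residual
    {s₀ : EuclideanSpace ℝ (Fin 3)} (hs₀ : s₀ ∈ fccSlots)
    (hcert : ExactOnly 0 (fccSlots.filter fun w => 0 < ⟪w, s₀⟫_ℝ)) (hfar : StarPairFar)
    (A₁ : EuclideanSpace ℝ (Fin 3) ≃ₗᵢ[ℝ] EuclideanSpace ℝ (Fin 3)) (t₁ : EuclideanSpace ℝ (Fin 3))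
    (A₂ : EuclideanSpace ℝ (Fin 3) ≃ₗᵢ[ℝ] EuclideanSpace ℝ (Fin 3)) (t₂ : EuclideanSpace ℝ (Fin 3))
    (hnr : ¬ (RayAlignedAt A₁ A₂ ∧ ¬ Sigma9OneSidedAt A₁ A₂ ∧ ¬ Sigma9OneSidedDownAt A₁ A₂ ∧ ¬ Sigma9TiltAt A₁ A₂ ∧
      ¬ Sigma9TiltDownAt A₁ A₂ ∧ ¬ Sigma9WideAt A₁ A₂ ∧ ¬ Sigma9WideDownAt A₁ A₂ ∧ ¬ SeparatedWideAt A₁ A₂ ∧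
      RegisteredAt A₁ t₁ A₂ t₂)) :
    GenericWallFloorAt A₁ t₁ A₂ t₂ := by
  by_cases hra : RayAlignedAt A₁ A₂
  swap
  · obtain ⟨u₁, hu₁, hst₁, u₂, hu₂, hst₂, hsep⟩ := exists_separated_of_not_rayAlignedAt hra
    exact genericWallFloorAt_chain_of_far hs₀ hcert hfar A₁ t₁ A₂ t₂ hu₁ hst₁ hu₂ hst₂ hsep
  by_cases h₁ : Sigma9OneSidedAt A₁ A₂
  · exact genericWallFloorAt_of_sigma9OneSidedAt hs₀ hcert hfar h₁ t₁ t₂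
  by_cases h₂ : Sigma9OneSidedDownAt A₁ A₂
  · exact genericWallFloorAt_of_sigma9OneSidedDownAt hs₀ hcert hfar h₂ t₁ t₂
  by_cases h₃ : Sigma9TiltAt A₁ A₂
  · exact genericWallFloorAt_of_sigma9TiltAt hs₀ hcert hfar h₃ t₁ t₂
  by_cases h₄ : Sigma9TiltDownAt A₁ A₂
  · exact genericWallFloorAt_of_sigma9TiltDownAt hs₀ hcert hfar h₄ t₁ t₂
  by_cases h₅ : Sigma9WideAt A₁ A₂
  · exact genericWallFloorAt_of_sigma9WideAt hs₀ hcert hfar h₅ t₁ t₂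
  by_cases h₆ : Sigma9WideDownAt A₁ A₂
  · exact genericWallFloorAt_of_sigma9WideDownAt hs₀ hcert hfar h₆ t₁ t₂
  by_cases h₇ : SeparatedWideAt A₁ A₂
  · exact genericWallFloorAt_of_separatedWideAt hs₀ hcert hfar h₇ t₁ t₂
  by_cases hreg : RegisteredAt A₁ t₁ A₂ t₂
  · exact absurd ⟨hra, h₁, h₂, h₃, h₄, h₅, h₆, h₇, hreg⟩ hnr
  · exact genericWallFloorAt_of_not_registeredAt hs₀ hcert hfar hreg

/-- **The same, keyed on lane T's `InResidualClass`** (`…TexShadowSplitDefs`, whose clause list IS the residual's hypothesis list):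
a non-co-axial pair outside the residual class satisfies `GenericWallFloorAt`, modulo `ExactOnly`(C12-55) and `StarPairFar`. -/
theorem genericWallFloorAt_of_not_inResidualClass
    {s₀ : EuclideanSpace ℝ (Fin 3)} (hs₀ : s₀ ∈ fccSlots)
    (hcert : ExactOnly 0 (fccSlots.filter fun w => 0 < ⟪w, s₀⟫_ℝ)) (hfar : StarPairFar)
    (A₁ : EuclideanSpace ℝ (Fin 3) ≃ₗᵢ[ℝ] EuclideanSpace ℝ (Fin 3)) (t₁ : EuclideanSpace ℝ (Fin 3))
    (A₂ : EuclideanSpace ℝ (Fin 3) ≃ₗᵢ[ℝ] EuclideanSpace ℝ (Fin 3)) (t₂ : EuclideanSpace ℝ (Fin 3))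
    (hnc : ¬ ∃ (L : EuclideanSpace ℝ (Fin 3) ≃ₗᵢ[ℝ] EuclideanSpace ℝ (Fin 3)) (r₁ r₂ : EuclideanSpace ℝ (Fin 3)) (σ σ' : ℤ → ℤ),
      IsHaggSeq σ ∧ IsHaggSeq σ' ∧
      (fun p => A₁ p + t₁) '' fccStacking 1 (Real.sqrt (2 / 3)) ⊆ (fun p => L p + r₁) '' barlowStacking 1 (Real.sqrt (2 / 3)) σ ∧
      (fun p => A₂ p + t₂) '' fccStacking 1 (Real.sqrt (2 / 3)) ⊆ (fun p => L p + r₂) '' barlowStacking 1 (Real.sqrt (2 / 3)) σ')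
    (hnr : ¬ Summit.Ventures.Crystal3D.Cruxes.TextureLiminf.TexShadow.InResidualClass A₁ A₂ t₁ t₂) :
    GenericWallFloorAt A₁ t₁ A₂ t₂ :=
  genericWallFloorAt_of_not_residual hs₀ hcert hfar A₁ t₁ A₂ t₂ fun h => hnr ⟨hnc, h⟩

/-! ## Deficiency form ⇒ adhesion form, pointwise -/

/-- **The currency converse for ONE cell.**  `X` `1`-separated with complete clamped plates `P₁ ⊆ Λ₁`, `P₂ ⊆ Λ₂` (windows
`[−2R₀, −R₀]`, `[h+R₀, h+2R₀]`, disc `ρ`, `1 ≤ R₀ ≤ ρ`): if the crux's deficiency-form inequality holds for the enumeration of `X`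
(`(φ₁+φ₂+c)πρ² − C(1+h)ρ ≤ D(X)`), then the adhesion form holds with the upper face-count constants `C₁`, `C₂` of
`affineSampleDeficit_upper` added. -/
theorem crossBound_of_deficiencyBound
    (A₁ : EuclideanSpace ℝ (Fin 3) ≃ₗᵢ[ℝ] EuclideanSpace ℝ (Fin 3)) (t₁ : EuclideanSpace ℝ (Fin 3))
    (A₂ : EuclideanSpace ℝ (Fin 3) ≃ₗᵢ[ℝ] EuclideanSpace ℝ (Fin 3)) (t₂ : EuclideanSpace ℝ (Fin 3))
    {c C C₁ C₂ R₀ h ρ : ℝ} (hR₀ρ : R₀ ≤ ρ)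
    (hC₁ : ∀ a b : ℝ, b - a = R₀ → ∀ ρ : ℝ, R₀ ≤ ρ → ∀ P : Finset (EuclideanSpace ℝ (Fin 3)),
      (∀ p, p ∈ P ↔ (p ∈ (fun q => A₁ q + t₁) '' fccStacking 1 (Real.sqrt (2 / 3)) ∧ a ≤ p 2 ∧ p 2 ≤ b ∧ p 0 ^ 2 + p 1 ^ 2 ≤ ρ ^ 2)) →
      contactDeficiency P ≤ 2 * (Real.sqrt 2 / 4 * ∑ᶠ w ∈ {w ∈ fccStacking 1 (Real.sqrt (2 / 3)) | ‖w‖ = 1},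
        |⟪w, A₁.symm (EuclideanSpace.single (2 : Fin 3) (1 : ℝ))⟫_ℝ|) * Real.pi * ρ ^ 2 + C₁ * ρ)
    (hC₂ : ∀ a b : ℝ, b - a = R₀ → ∀ ρ : ℝ, R₀ ≤ ρ → ∀ P : Finset (EuclideanSpace ℝ (Fin 3)),
      (∀ p, p ∈ P ↔ (p ∈ (fun q => A₂ q + t₂) '' fccStacking 1 (Real.sqrt (2 / 3)) ∧ a ≤ p 2 ∧ p 2 ≤ b ∧ p 0 ^ 2 + p 1 ^ 2 ≤ ρ ^ 2)) →
      contactDeficiency P ≤ 2 * (Real.sqrt 2 / 4 * ∑ᶠ w ∈ {w ∈ fccStacking 1 (Real.sqrt (2 / 3)) | ‖w‖ = 1},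
        |⟪w, A₂.symm (EuclideanSpace.single (2 : Fin 3) (1 : ℝ))⟫_ℝ|) * Real.pi * ρ ^ 2 + C₂ * ρ)
    (X P₁ P₂ : Finset (EuclideanSpace ℝ (Fin 3)))
    (hP₁X : P₁ ⊆ X) (hP₂X : P₂ ⊆ X \ P₁)
    (hP₁ : ∀ p, p ∈ P₁ ↔ (p ∈ (fun q => A₁ q + t₁) '' fccStacking 1 (Real.sqrt (2 / 3)) ∧
      -(2 * R₀) ≤ p 2 ∧ p 2 ≤ -R₀ ∧ p 0 ^ 2 + p 1 ^ 2 ≤ ρ ^ 2))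
    (hP₂ : ∀ p, p ∈ P₂ ↔ (p ∈ (fun q => A₂ q + t₂) '' fccStacking 1 (Real.sqrt (2 / 3)) ∧
      h + R₀ ≤ p 2 ∧ p 2 ≤ h + 2 * R₀ ∧ p 0 ^ 2 + p 1 ^ 2 ≤ ρ ^ 2))
    (hDX : (Real.sqrt 2 / 4 * ∑ᶠ w ∈ {w ∈ fccStacking 1 (Real.sqrt (2 / 3)) | ‖w‖ = 1},
          |⟪w, A₁.symm (EuclideanSpace.single (2 : Fin 3) (1 : ℝ))⟫_ℝ| +
        Real.sqrt 2 / 4 * ∑ᶠ w ∈ {w ∈ fccStacking 1 (Real.sqrt (2 / 3)) | ‖w‖ = 1},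
          |⟪w, A₂.symm (EuclideanSpace.single (2 : Fin 3) (1 : ℝ))⟫_ℝ| + c) * Real.pi * ρ ^ 2 - C * (1 + h) * ρ ≤
        contactDeficiency X) :
    ((((P₁ ×ˢ (X \ P₁)).filter fun pq => dist pq.1 pq.2 = 1).card : ℕ) : ℝ) +
      ((((P₂ ×ˢ ((X \ P₁) \ P₂)).filter fun pq => dist pq.1 pq.2 = 1).card : ℕ) : ℝ) ≤
      contactDeficiency ((X \ P₁) \ P₂) +
        (Real.sqrt 2 / 4 * ∑ᶠ w ∈ {w ∈ fccStacking 1 (Real.sqrt (2 / 3)) | ‖w‖ = 1},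
            |⟪w, A₁.symm (EuclideanSpace.single (2 : Fin 3) (1 : ℝ))⟫_ℝ| +
          Real.sqrt 2 / 4 * ∑ᶠ w ∈ {w ∈ fccStacking 1 (Real.sqrt (2 / 3)) | ‖w‖ = 1},
            |⟪w, A₂.symm (EuclideanSpace.single (2 : Fin 3) (1 : ℝ))⟫_ℝ| - c) * Real.pi * ρ ^ 2 +
        (C * (1 + h) + C₁ + C₂) * ρ := by
  have hD₁ := hC₁ (-(2 * R₀)) (-R₀) (by ring) ρ hR₀ρ P₁ hP₁
  have hD₂ := hC₂ (h + R₀) (h + 2 * R₀) (by ring) ρ hR₀ρ P₂ hP₂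
  have hsplit₁ := contactDeficiency_sdiff_split hP₁X
  have hsplit₂ := contactDeficiency_sdiff_split hP₂X
  have hcross : ((((P₁ ×ˢ (X \ P₁)).filter fun pq => dist pq.1 pq.2 = 1).card : ℕ) : ℝ) +
      ((((P₂ ×ˢ ((X \ P₁) \ P₂)).filter fun pq => dist pq.1 pq.2 = 1).card : ℕ) : ℝ) =
      contactDeficiency P₁ + contactDeficiency P₂ + contactDeficiency ((X \ P₁) \ P₂) - contactDeficiency X := by
    linarith only [hsplit₁, hsplit₂]
  rw [hcross]
  nlinarith only [hD₁, hD₂, hDX]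

/-- **Deficiency-form matrix at explicit `(C, R₀)`, `R₀ ≥ 1` ⇒ `TwoSlabLedgerAt c`** (adhesion form, the currency of lane T's cells
up to `½·innerBonds` and the table).  The route decl's `GenericWallFloorAtCharge` only records `R₀ > 0`, so the converse is stated on
the matrix. -/
theorem twoSlabLedgerAt_of_atCharge {c : ℝ}
    (A₁ : EuclideanSpace ℝ (Fin 3) ≃ₗᵢ[ℝ] EuclideanSpace ℝ (Fin 3)) (t₁ : EuclideanSpace ℝ (Fin 3))
    (A₂ : EuclideanSpace ℝ (Fin 3) ≃ₗᵢ[ℝ] EuclideanSpace ℝ (Fin 3)) (t₂ : EuclideanSpace ℝ (Fin 3))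
    {C R₀ : ℝ} (hR₀ : 1 ≤ R₀)
    (hAt : ∀ h : ℝ, 0 ≤ h → ∀ ρ : ℝ, R₀ ≤ ρ → ∀ (N : ℕ) (x : Fin N → EuclideanSpace ℝ (Fin 3)),
      Summit.Ventures.Crystal3D.IsUnitPacking x → (∀ i, -(2 * R₀) ≤ x i 2 ∧ x i 2 ≤ h + 2 * R₀ ∧ x i 0 ^ 2 + x i 1 ^ 2 ≤ ρ ^ 2) →
      (∀ p ∈ (fun p => A₁ p + t₁) '' fccStacking 1 (Real.sqrt (2 / 3)),
        (-(2 * R₀) ≤ p 2 ∧ p 2 ≤ -R₀ ∧ p 0 ^ 2 + p 1 ^ 2 ≤ ρ ^ 2) → ∃ i, x i = p) →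
      (∀ p ∈ (fun p => A₂ p + t₂) '' fccStacking 1 (Real.sqrt (2 / 3)),
        (h + R₀ ≤ p 2 ∧ p 2 ≤ h + 2 * R₀ ∧ p 0 ^ 2 + p 1 ^ 2 ≤ ρ ^ 2) → ∃ i, x i = p) →
      (Real.sqrt 2 / 4 * ∑ᶠ w ∈ {w ∈ fccStacking 1 (Real.sqrt (2 / 3)) | ‖w‖ = 1},
          |⟪w, A₁.symm (EuclideanSpace.single (2 : Fin 3) (1 : ℝ))⟫_ℝ| +
        Real.sqrt 2 / 4 * ∑ᶠ w ∈ {w ∈ fccStacking 1 (Real.sqrt (2 / 3)) | ‖w‖ = 1},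
          |⟪w, A₂.symm (EuclideanSpace.single (2 : Fin 3) (1 : ℝ))⟫_ℝ| + c) * Real.pi * ρ ^ 2 - C * (1 + h) * ρ ≤
        6 * (N : ℝ) - (Summit.Ventures.Crystal3D.numContacts x : ℝ)) :
    TwoSlabLedgerAt c A₁ t₁ A₂ t₂ := by
  classical
  obtain ⟨C₁, hC₁⟩ := affineSampleDeficit_upper A₁ t₁ R₀ hR₀
  obtain ⟨C₂, hC₂⟩ := affineSampleDeficit_upper A₂ t₂ R₀ hR₀
  refine ⟨|C| + |C₁| + |C₂|, R₀, hR₀, ?_⟩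
  intro h hh ρ hρ X P₁ P₂ hX hP₁X hP₂X hcell hP₁ hP₂
  -- enumerate `X` as a unit packing
  set N := X.card with hN
  set x : Fin N → EuclideanSpace ℝ (Fin 3) := fun i => ((X.equivFin.symm i : X) : _) with hxdef
  have hxmem : ∀ i, x i ∈ X := fun i => (X.equivFin.symm i).2
  have hxinj : Function.Injective x := fun i j hij => X.equivFin.symm.injective (Subtype.ext hij)
  have himage : univ.image x = X := by
    ext p
    simp only [mem_image, mem_univ, true_and]
    constructor
    · rintro ⟨i, rfl⟩; exact hxmem i
    · intro hp; exact ⟨X.equivFin ⟨p, hp⟩, by simp [hxdef]⟩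
  have hpack : Summit.Ventures.Crystal3D.IsUnitPacking x := fun i j hij =>
    hX (x i) (hxmem i) (x j) (hxmem j) fun heq => hij (hxinj heq)
  have hsurj : ∀ p ∈ X, ∃ i, x i = p := fun p hp => ⟨X.equivFin ⟨p, hp⟩, by simp [hxdef]⟩
  have hDX' := hAt h hh ρ hρ N x hpack (fun i => hcell (x i) (hxmem i))
    (fun p hpΛ hwin => hsurj p (hP₁X ((hP₁ p).2 ⟨hpΛ, hwin⟩)))
    (fun p hpΛ hwin => hsurj p (Finset.sdiff_subset (hP₂X ((hP₂ p).2 ⟨hpΛ, hwin⟩))))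
  rw [← contactDeficiency_image_eq x hxinj, himage] at hDX'
  have hρ0 : 0 ≤ ρ := by linarith
  have key := crossBound_of_deficiencyBound A₁ t₁ A₂ t₂ hρ hC₁ hC₂ X P₁ P₂ hP₁X hP₂X hP₁ hP₂ hDX'
  have hconst : (C * (1 + h) + C₁ + C₂) * ρ ≤ (|C| + |C₁| + |C₂|) * (1 + h) * ρ := by
    have h1 : C * (1 + h) ≤ |C| * (1 + h) := mul_le_mul_of_nonneg_right (le_abs_self C) (by linarith)
    have h2 : C₁ ≤ |C₁| * (1 + h) := by
      have := le_abs_self C₁; have h0 : 0 ≤ |C₁| * h := mul_nonneg (abs_nonneg _) hh; nlinarith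
    have h3 : C₂ ≤ |C₂| * (1 + h) := by
      have := le_abs_self C₂; have h0 : 0 ≤ |C₂| * h := mul_nonneg (abs_nonneg _) hh; nlinarith
    have h4 : C * (1 + h) + C₁ + C₂ ≤ (|C| + |C₁| + |C₂|) * (1 + h) := by linarith
    exact mul_le_mul_of_nonneg_right h4 hρ0
  linarith only [key, hconst]

end Summit.Ventures.Crystal3D.Theorems

end
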